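import Summits.AtomisticToContinuum.Crystallization.Theorems.FrustratedLawDichotomyStrainedPatchHomEntryLeafHTA2QCellB9V1

/-!
# THE FULL `2⁻⁹` BULK CELL UNDER THE SHARP THIRD-ORDER REMAINDER (v3), part 2: far sum, ONE inner leaf on the SMALLER confined box, END TO END
# (27623 `(H) HomFloor (1/625)`, hcp half; hand-1 g37; critic rows 1368 (2) / 1408 (4))

decomp-a2c hand-1 g37 (crux `AperiodicFrustratedLawGap`, stmt-AtomisticToContinuum-27623).  With `…CellB9V1` (`pB9V`, `GnB9V`, `restB9V`, `linB9V`) and the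
RE-USED quadratic-component facts `qB9_0/1/2` of `…CellB9S1`: ★ `farB9V`, ★★★ `htCertSideA2QS_B9V` (`htCertSideA2QS_of_parts`), ★ `treeA2QS_B9V` — ONE inner hull
leaf of the squared-test verdict on the confined box `htWr pB9V` (radii `0.793 ×` those of `pB9A2`), ★★★ `entryLeafOKHT4A2QSQDCRS_B9V` END TO END and the
v3 ∃-tree `okS3_B9`.  This is the first production cell certified in the v3 currency (`…EntryLeafHTA2QSVerdict`); every v2/v1 cell enters v3 through
`exists_tree_HT4A2QQDCRS3_of_SE`.

Kernel facts + assembly; 0 sorry; standard axioms; no instances / notation / `#eval`.  `--supports stmt-AtomisticToContinuum-27623`.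
-/

namespace Summit.AtomisticToContinuum.Crystallization.Theorems.FrustratedLawDichotomyStrainedPatchHomEntryLeafHT

open Literature.Analysis.ValidatedNumerics.Numerics
open Summit.AtomisticToContinuum.Crystallization.Theorems.FrustratedLawDichotomyStrainedPatchHomCertTree (CertTree treeOK)
open Summit.AtomisticToContinuum.Crystallization.Theorems.FrustratedLawDichotomyStrainedPatchHomEntryTable (muRec)
open Summit.AtomisticToContinuum.Crystallization.Theorems.FrustratedLawDichotomyStrainedPatchHomEntryFitHcpCentred (entryLeafOKHQDCRS)
open Summit.AtomisticToContinuum.Crystallization.Theorems.FrustratedLawDichotomyStrainedPatchHomSlopeLJ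
open Summit.AtomisticToContinuum.Crystallization.Theorems.FrustratedLawDichotomyStrainedPatchHomSlopeLJAffine
open Summit.AtomisticToContinuum.Crystallization.Theorems.FrustratedLawDichotomyStrainedPatchHomSlopeLJAffine2Kit

set_option maxRecDepth 100000 in
set_option maxHeartbeats 4000000 in
/-- ★ KERNEL: `GnB9V + far₁ + far₂ = 936085947535 ≤ pB9V.Gs`. -/
theorem farB9V : GnB9V + htGsNA cB065 wB9A JB065 (htFar1U cB065 wB9A) + htGsNA cB065 wB9A JB065 (htFar2U cB065 wB9A) ≤ pB9V.Gs := by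
  decide +kernel

/-- ★★★ **THE SHARP-REMAINDER CERTIFICATE SIDE OF THE `2⁻⁹` BULK CELL HOLDS** (`restB9V`, the re-used `qB9_0/1/2`, `linB9V`, `farB9V`). [assembly] -/
theorem htCertSideA2QS_B9V : htCertSideA2QS pB9V QB9 GnB9V JB065 cB065 wB9A = true :=
  htCertSideA2QS_of_parts restB9V qB9_0 qB9_1 qB9_2 linB9V farB9V

set_option maxRecDepth 100000 in
set_option maxHeartbeats 4000000 in
/-- ★ KERNEL: ONE inner hull leaf of the squared-test inner verdict closes the SHARP confined box `htWr pB9V` of the full `2⁻⁹` cell. -/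
theorem treeA2QS_B9V : treeOK (hullInner (entryLeafOKHQDCRS muRec qX90c) JB065 cB065) CertTree.leaf cB065 (htWr pB9V cB065 wB9A) = true := by
  decide +kernel

/-- ★★★ **THE FULL `2⁻⁹` BULK CELL CLOSES END TO END IN THE v3 CURRENCY** (sharp third-order remainder on the certificate side, squared inner test, ONE
inner leaf). [assembly] -/
theorem entryLeafOKHT4A2QSQDCRS_B9V : entryLeafOKHT4A2QSQDCRS muRec qX90c pB9V QB9 GnB9V JB065 CertTree.leaf cB065 wB9A = true :=
  entryLeafOKHT4A2QSQDCRS_of_parts htCertSideA2QS_B9V treeA2QS_B9V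

/-- ★ … hence the FULL `2⁻⁹` cell is a one-leaf ∃-tree of the production verdict v3 `entryLeafOKHT4A2QQDCRS3 muRec`. [formal bookkeeping] -/
theorem okS3_B9 : ∃ t : CertTree ((Fin 3 × Fin 3) ⊕ Fin 3), treeOK (entryLeafOKHT4A2QQDCRS3 muRec) t cB065 wB9A = true :=
  exists_tree_HT4A2QQDCRS3_of_certS3 entryLeafOKHT4A2QSQDCRS_B9V

end Summit.AtomisticToContinuum.Crystallization.Theorems.FrustratedLawDichotomyStrainedPatchHomEntryLeafHT
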